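import Literature.Barriers.RiemannHypothesis.EpsteinZetaChowlaSelbergSeries
import HarnessLib

/-!
# Regrouping `Σ_{n,m ≥ 1} n^{½−s} m^{s−½} cos(πnm b/a) K_{s−½}(2πknm)` by `N = nm`: the divisor sums of (4)

Proof file towards `Literature.Barriers.RiemannHypothesis.BatemanGrosswald1964_thm1`
(the Chowla–Selberg formula, Bateman–Grosswald 1964, Theorem 1); no new definitions. Summing the
`K`-Bessel expansions of the lattice lines `n = 1, 2, …` (files
`EpsteinZetaChowlaSelbergLine{Theta,Sum}.lean`) produces the absolutely convergent double series
`Σ_{n≥1} Σ_{m≥1} n^{½−s} m^{s−½} cos(π nm b/a) K_{s−½}(2πk nm)`; grouping the terms with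
`nm = N` gives `Σ_{d∣N} d^{½−s}(N/d)^{s−½} = N^{s−½} σ_{1−2s}(N)`, i.e. exactly the `N`-th term
`N^{s−½} σ_{1−2s}(N) cos(Nπb/a) K_{s−½}(2πkN)` of Bateman–Grosswald's (4) (`bgHTerm`). This is
`tsum_tsum_eq_tsum_bgHTerm` below; the regrouping is Mathlib's equivalence
`sigmaAntidiagonalEquivProd : (Σ N : ℕ+, divisorsAntidiagonal N) ≃ ℕ+ × ℕ+`, and absolute
convergence comes from the exponential decay of `K` (`BesselKMellin.lean`) through
`e^{−2πk nm} ≤ e^{2πk} e^{−2πkn} e^{−2πkm}`.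

## References

* [BatemanGrosswald1964] P. T. Bateman, E. Grosswald, *On Epstein's zeta function*, Acta Arith. 9
  (1964) 365–373, Theorem 1 (4) and its proof.
-/

noncomputable section

open Filter Topology

namespace Literature.Barriers.RiemannHypothesis

open Literature.Analysis.FunctionSpaces
open Literature.Analysis.Complex.Polya1926 (polyaM polyaM_nonneg)

variable {a b c : ℝ}

/-! ## The double-series term and its bound -/

/-- `nm + 1 ≥ n + m` for `n, m ≥ 1`. [folklore] -/
theorem add_le_mul_add_one {n m : ℕ} (hn : 0 < n) (hm : 0 < m) : n + m ≤ n * m + 1 := by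
  obtain ⟨n, rfl⟩ := Nat.exists_eq_succ_of_ne_zero hn.ne'
  obtain ⟨m, rfl⟩ := Nat.exists_eq_succ_of_ne_zero hm.ne'
  ring_nf
  nlinarith

/-- **Bound for the double-series term**: for `n, m ≥ 1`,
`|n^{½−s} m^{s−½} cos(π nm b/a) K_{s−½}(2πk nm)| ≤ C · (n^A e^{−2πkn}) (m^A e^{−2πkm})` with
`A = ⌈|σ − ½|⌉`, `C = ½ e^{4πk} M₀(2πk, s − ½)`. [folklore] -/
theorem norm_doubleTerm_le (h : IsPosDefForm a b c) (s : ℂ) {n m : ℕ} (hn : 0 < n) (hm : 0 < m) :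
    ‖((n : ℕ) : ℂ) ^ (1 / 2 - s) * ((m : ℕ) : ℂ) ^ (s - 1 / 2) *
        (Real.cos (((n * m : ℕ) : ℝ) * Real.pi * b / a) : ℂ) *
        besselK (s - 1 / 2) ((2 * Real.pi * starkK a b c * ((n * m : ℕ) : ℝ) : ℝ) : ℂ)‖ ≤
      (Real.exp (2 * (2 * Real.pi * starkK a b c)) / 2 *
          polyaM 0 (2 * Real.pi * starkK a b c) (s - 1 / 2)) *
        (((n : ℝ) ^ ⌈|s.re - 1 / 2|⌉₊ * Real.exp (-(2 * Real.pi * starkK a b c) * n)) *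
          ((m : ℝ) ^ ⌈|s.re - 1 / 2|⌉₊ * Real.exp (-(2 * Real.pi * starkK a b c) * m))) := by
  set κ := 2 * Real.pi * starkK a b c with hκ
  have hκ0 : 0 < κ := by have := starkK_pos h; positivity
  set A : ℕ := ⌈|s.re - 1 / 2|⌉₊ with hA
  have hA' : |s.re - 1 / 2| ≤ (A : ℝ) := Nat.le_ceil _
  have hnm : 0 < n * m := Nat.mul_pos hn hm
  have e1 : ‖((n : ℕ) : ℂ) ^ (1 / 2 - s)‖ ≤ (n : ℝ) ^ A := by
    rw [Complex.norm_natCast_cpow_of_pos hn]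
    refine natCast_rpow_le_pow hn ?_
    have : (1 / 2 - s).re = -(s.re - 1 / 2) := by simp
    rw [this]
    exact (neg_le_abs _).trans hA'
  have e2 : ‖((m : ℕ) : ℂ) ^ (s - 1 / 2)‖ ≤ (m : ℝ) ^ A := by
    rw [Complex.norm_natCast_cpow_of_pos hm]
    refine natCast_rpow_le_pow hm ?_
    have : (s - 1 / 2).re = s.re - 1 / 2 := by simp
    rw [this]
    exact (le_abs_self _).trans hA'
  have e3 : ‖(Real.cos (((n * m : ℕ) : ℝ) * Real.pi * b / a) : ℂ)‖ ≤ 1 := by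
    rw [Complex.norm_real, Real.norm_eq_abs]; exact Real.abs_cos_le_one _
  have e4 : ‖besselK (s - 1 / 2) ((2 * Real.pi * starkK a b c * ((n * m : ℕ) : ℝ) : ℝ) : ℂ)‖ ≤
      Real.exp (κ - κ * ((n * m : ℕ) : ℝ)) / 2 * polyaM 0 κ (s - 1 / 2) := by
    have hax : κ ≤ κ * ((n * m : ℕ) : ℝ) :=
      le_mul_of_one_le_right hκ0.le (by exact_mod_cast hnm)
    have := Literature.Analysis.FunctionSpaces.norm_besselK_le hκ0 hax (s - 1 / 2)
    rwa [hκ] at this ⊢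
  have hM : 0 ≤ polyaM 0 κ (s - 1 / 2) := polyaM_nonneg _ _ _
  -- `e^{κ - κ nm} ≤ e^{2κ} e^{-κ n} e^{-κ m}`
  have e5 : Real.exp (κ - κ * ((n * m : ℕ) : ℝ)) ≤
      Real.exp (2 * κ) * (Real.exp (-κ * n) * Real.exp (-κ * m)) := by
    rw [← Real.exp_add, ← Real.exp_add]
    apply Real.exp_le_exp.2
    have hle : ((n : ℝ) + m) ≤ (n * m : ℕ) + 1 := by exact_mod_cast add_le_mul_add_one hn hm
    push_cast at hle ⊢
    nlinarith
  rw [norm_mul, norm_mul, norm_mul]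
  calc ‖((n : ℕ) : ℂ) ^ (1 / 2 - s)‖ * ‖((m : ℕ) : ℂ) ^ (s - 1 / 2)‖ *
        ‖(Real.cos (((n * m : ℕ) : ℝ) * Real.pi * b / a) : ℂ)‖ *
        ‖besselK (s - 1 / 2) ((2 * Real.pi * starkK a b c * ((n * m : ℕ) : ℝ) : ℝ) : ℂ)‖
      ≤ (n : ℝ) ^ A * (m : ℝ) ^ A * 1 * (Real.exp (κ - κ * ((n * m : ℕ) : ℝ)) / 2 *
          polyaM 0 κ (s - 1 / 2)) := by gcongr
    _ ≤ (n : ℝ) ^ A * (m : ℝ) ^ A * 1 * (Real.exp (2 * κ) * (Real.exp (-κ * n) * Real.exp (-κ * m)) / 2 *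
          polyaM 0 κ (s - 1 / 2)) := by gcongr
    _ = _ := by ring

/-- **The double series converges absolutely** over `ℕ+ × ℕ+`. [folklore] -/
theorem summable_doubleTerm (h : IsPosDefForm a b c) (s : ℂ) :
    Summable fun p : ℕ+ × ℕ+ => (((p.1 : ℕ) : ℕ) : ℂ) ^ (1 / 2 - s) * (((p.2 : ℕ) : ℕ) : ℂ) ^ (s - 1 / 2) *
        (Real.cos ((((p.1 : ℕ) * (p.2 : ℕ) : ℕ) : ℝ) * Real.pi * b / a) : ℂ) *
        besselK (s - 1 / 2)
          ((2 * Real.pi * starkK a b c * (((p.1 : ℕ) * (p.2 : ℕ) : ℕ) : ℝ) : ℝ) : ℂ) := by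
  have hκ0 : 0 < 2 * Real.pi * starkK a b c := by have := starkK_pos h; positivity
  set A : ℕ := ⌈|s.re - 1 / 2|⌉₊ with hA
  set g : ℕ+ → ℝ := fun n => ((n : ℕ) : ℝ) ^ A * Real.exp (-(2 * Real.pi * starkK a b c) * (n : ℕ))
    with hg
  have hgs : Summable g :=
    (Real.summable_pow_mul_exp_neg_nat_mul A hκ0).comp_injective PNat.coe_injective
  have hg0 : 0 ≤ g := fun n => by simp only [hg]; positivity
  have hprod := ((hgs.mul_of_nonneg hgs hg0 hg0).mul_left
    (Real.exp (2 * (2 * Real.pi * starkK a b c)) / 2 *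
      polyaM 0 (2 * Real.pi * starkK a b c) (s - 1 / 2)))
  refine Summable.of_norm_bounded hprod fun p => ?_
  exact norm_doubleTerm_le h s p.1.pos p.2.pos

/-! ## The divisor sums -/

/-- **`Σ_{d∣N} d^{½−s} (N/d)^{s−½} = N^{s−½} σ_{1−2s}(N)`** (both sides vanish at `N = 0`).
[folklore] -/
theorem sum_divisors_cpow_mul_cpow (s : ℂ) (N : ℕ) :
    ∑ d ∈ N.divisors, ((d : ℕ) : ℂ) ^ (1 / 2 - s) * (((N / d : ℕ) : ℕ) : ℂ) ^ (s - 1 / 2) =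
      ((N : ℕ) : ℂ) ^ (s - 1 / 2) * sigmaC (1 - 2 * s) N := by
  unfold sigmaC
  rw [Finset.mul_sum]
  refine Finset.sum_congr rfl fun d hd => ?_
  have hd0 : 0 < d := Nat.pos_of_mem_divisors hd
  have hdvd : d ∣ N := Nat.dvd_of_mem_divisors hd
  have hdC : ((d : ℕ) : ℂ) ≠ 0 := by exact_mod_cast hd0.ne'
  have e : (((N / d : ℕ) : ℕ) : ℂ) = (((N : ℝ) / (d : ℝ) : ℝ) : ℂ) := by
    push_cast
    rw [Nat.cast_div hdvd (by exact_mod_cast hd0.ne')]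
  rw [e, ofReal_div_cpow (Nat.cast_nonneg N) (by exact_mod_cast hd0) (s - 1 / 2)]
  push_cast
  rw [show ((d : ℕ) : ℂ) ^ (1 - 2 * s) = ((d : ℕ) : ℂ) ^ (1 / 2 - s) * ((d : ℕ) : ℂ) ^ (-(s - 1 / 2)) by
    rw [← Complex.cpow_add _ _ hdC]; congr 1; ring]
  ring

/-- The fibre of the double series over `N`: `Σ_{(n,m): nm = N} n^{½−s} m^{s−½} cos(π nm b/a)
K_{s−½}(2πk nm)` is the `N`-th term of (4). [cite: BatemanGrosswald1964, Theorem 1 (4)] -/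
theorem sum_divisorsAntidiagonal_doubleTerm (a b c : ℝ) (s : ℂ) (N : ℕ) :
    ∑ x ∈ N.divisorsAntidiagonal, ((x.1 : ℕ) : ℂ) ^ (1 / 2 - s) * ((x.2 : ℕ) : ℂ) ^ (s - 1 / 2) *
        (Real.cos (((x.1 * x.2 : ℕ) : ℝ) * Real.pi * b / a) : ℂ) *
        besselK (s - 1 / 2) ((2 * Real.pi * starkK a b c * ((x.1 * x.2 : ℕ) : ℝ) : ℝ) : ℂ) =
      bgHTerm a b c s N := by
  rw [Nat.sum_divisorsAntidiagonal (fun i j => ((i : ℕ) : ℂ) ^ (1 / 2 - s) * ((j : ℕ) : ℂ) ^ (s - 1 / 2) *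
        (Real.cos (((i * j : ℕ) : ℝ) * Real.pi * b / a) : ℂ) *
        besselK (s - 1 / 2) ((2 * Real.pi * starkK a b c * ((i * j : ℕ) : ℝ) : ℝ) : ℂ))]
  have hfac : ∀ d ∈ N.divisors, d * (N / d) = N := fun d hd =>
    Nat.mul_div_cancel' (Nat.dvd_of_mem_divisors hd)
  rw [Finset.sum_congr rfl fun d hd => by rw [hfac d hd], ← Finset.sum_mul, ← Finset.sum_mul,
    sum_divisors_cpow_mul_cpow s N]
  unfold bgHTerm
  ring

/-! ## The regrouping -/

/-- **Regrouping by `N = nm`**: the double series over `ℕ+ × ℕ+` equals `Σ_{N≥1} bgHTerm(N)`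
(Mathlib's `sigmaAntidiagonalEquivProd`). [cite: BatemanGrosswald1964, Theorem 1 (4) and proof] -/
theorem tsum_doubleTerm_eq_tsum_bgHTerm (h : IsPosDefForm a b c) (s : ℂ) :
    (∑' p : ℕ+ × ℕ+, (((p.1 : ℕ) : ℕ) : ℂ) ^ (1 / 2 - s) * (((p.2 : ℕ) : ℕ) : ℂ) ^ (s - 1 / 2) *
        (Real.cos ((((p.1 : ℕ) * (p.2 : ℕ) : ℕ) : ℝ) * Real.pi * b / a) : ℂ) *
        besselK (s - 1 / 2)
          ((2 * Real.pi * starkK a b c * (((p.1 : ℕ) * (p.2 : ℕ) : ℕ) : ℝ) : ℝ) : ℂ)) =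
      ∑' N : ℕ, bgHTerm a b c s (N + 1) := by
  set u : ℕ → ℕ → ℂ := fun i j => ((i : ℕ) : ℂ) ^ (1 / 2 - s) * ((j : ℕ) : ℂ) ^ (s - 1 / 2) *
        (Real.cos (((i * j : ℕ) : ℝ) * Real.pi * b / a) : ℂ) *
        besselK (s - 1 / 2) ((2 * Real.pi * starkK a b c * ((i * j : ℕ) : ℝ) : ℝ) : ℂ) with hu
  have hU : Summable fun p : ℕ+ × ℕ+ => u p.1 p.2 := summable_doubleTerm h s
  change ∑' p : ℕ+ × ℕ+, u p.1 p.2 = _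
  -- transport to the sigma type of divisor pairs
  have hσ : Summable fun x : (Σ N : ℕ+, (N : ℕ).divisorsAntidiagonal) =>
      u (sigmaAntidiagonalEquivProd x).1 (sigmaAntidiagonalEquivProd x).2 :=
    (sigmaAntidiagonalEquivProd.summable_iff (f := fun p : ℕ+ × ℕ+ => u p.1 p.2)).2 hU
  rw [← sigmaAntidiagonalEquivProd.tsum_eq (fun p : ℕ+ × ℕ+ => u p.1 p.2), hσ.tsum_sigma,
    ← tsum_pnat_eq_tsum_succ (f := fun N => bgHTerm a b c s N)]
  refine tsum_congr fun N => ?_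
  rw [tsum_fintype, Finset.univ_eq_attach, ← sum_divisorsAntidiagonal_doubleTerm a b c s N,
    ← Finset.sum_attach ((N : ℕ).divisorsAntidiagonal)]
  refine Finset.sum_congr rfl fun x _ => ?_
  simp only [sigmaAntidiagonalEquivProd, divisorsAntidiagonalFactors, Equiv.coe_fn_mk, PNat.mk_coe, hu]

/-- **The iterated form**: `Σ_{n≥1} Σ_{m≥1} n^{½−s} m^{s−½} cos(π nm b/a) K_{s−½}(2πk nm)
= Σ_{N≥1} N^{s−½} σ_{1−2s}(N) cos(Nπb/a) K_{s−½}(2πkN)` (sums over `ℕ` shifted by one).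
[cite: BatemanGrosswald1964, Theorem 1 (4) and proof] -/
theorem tsum_tsum_eq_tsum_bgHTerm (h : IsPosDefForm a b c) (s : ℂ) :
    (∑' n : ℕ, ∑' m : ℕ, (((n + 1 : ℕ) : ℕ) : ℂ) ^ (1 / 2 - s) * (((m + 1 : ℕ) : ℕ) : ℂ) ^ (s - 1 / 2) *
        (Real.cos ((((n + 1) * (m + 1) : ℕ) : ℝ) * Real.pi * b / a) : ℂ) *
        besselK (s - 1 / 2) ((2 * Real.pi * starkK a b c * (((n + 1) * (m + 1) : ℕ) : ℝ) : ℝ) : ℂ)) =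
      ∑' N : ℕ, bgHTerm a b c s (N + 1) := by
  set u : ℕ → ℕ → ℂ := fun i j => ((i : ℕ) : ℂ) ^ (1 / 2 - s) * ((j : ℕ) : ℂ) ^ (s - 1 / 2) *
        (Real.cos (((i * j : ℕ) : ℝ) * Real.pi * b / a) : ℂ) *
        besselK (s - 1 / 2) ((2 * Real.pi * starkK a b c * ((i * j : ℕ) : ℝ) : ℝ) : ℂ) with hu
  have hU : Summable fun p : ℕ+ × ℕ+ => u p.1 p.2 := summable_doubleTerm h s
  have h1 := tsum_doubleTerm_eq_tsum_bgHTerm h s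
  change ∑' p : ℕ+ × ℕ+, u p.1 p.2 = _ at h1
  rw [hU.tsum_prod] at h1
  change ∑' n : ℕ, ∑' m : ℕ, u (n + 1) (m + 1) = _
  rw [← h1, ← tsum_pnat_eq_tsum_succ (f := fun n : ℕ => ∑' m : ℕ, u n (m + 1))]
  refine tsum_congr fun n => ?_
  exact (tsum_pnat_eq_tsum_succ (f := fun m : ℕ => u n m)).symm

end Literature.Barriers.RiemannHypothesis
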